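import Summits.ValiantsHypothesis.ValiantsHypothesis.Theorems.LacunarySymmetroidMatrixDescartesCensusDoorA34FlagDescent

/-!
# `MatrixDescartes` census — DOOR A at `(3,4)`: the SUB-STRATUM LIFT at the TOP end, and the door / stub readings

HONEST FRAMING.  Object-search cell `pub-symmetroid`, engine seat `val-sym-eng-2` (g2); helper file beside the registered strata line
`Cruxes/DoorA34/Lines/strata.lean` on stmt-ValiantsHypothesis-19980 (`DoorA34 = PosRootLawAt 3 4 18`: OPEN, typed, never asserted here).
MODULE NOTE (desk R2448 (B), OPS15): re-cut of the unfiled reader `…SubStratumLiftTop` onto the built chain — imports `…FlagDescent`.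
Companion of `…CensusDoorA34FlagDescent` (bottom end, chain currency).  Here, by letter reversal `t ↦ 1/t` exactly as in the
tree's `nineteen_of_nullTop_eighteen`:

* `card_posRoots_of_nullTop_subStratum_step` — **SUB-STRATUM LIFT (top end, one step)**: `d l < d 3` (`l ≠ 3`), `d l < d 2`
  (`l ∉ {2,3}`), `det S₃ = 0`, `tr(adj S₃·S₂) = 0` (p575885's sub-stratum), `kᵀ adj(S₃) k ≠ 0`, an alternation chain of `N + 1`
  positive points ⇒ `S₂ ↦ S₂ + η·kkᵀ` (same support, `S₃` untouched: the GENERIC null-top sheet) has `≥ N + 1` distinct positive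
  roots — with `N = 17`: a sub-stratum chain-SEVENTEEN lifts to a null-top EIGHTEEN;
* `card_posRoots_of_nullTop_subStratum` — then unfolding `S₃` as well gives `≥ N + 2` (a sub-stratum chain-`17` lifts to a NINETEEN);
* DOOR READINGS: `no_nullTop_subStratum_seventeen_of_posRootLawOn`, `no_nullNull_subStratum_sixteen_of_posRootLawOn` — a kernel row
  `PosRootLawOn 3 4 18 d` excludes sub-stratum chain-SEVENTEENS and null-null sub-stratum chain-SIXTEENS on `d`;
* STUB READINGS: `no_nullTop_subStratum_seventeen_of_nullTopCeiling`, `no_nullNull_subStratum_sixteen_of_nullNullCeiling` — the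
  line's stubs `stub_nullTopCeiling` / `stub_nullNullCeiling`, taken VERBATIM as hypotheses (not claimed), force the SAME exclusions:
  a sub-stratum chain-`17` lifts in one step to a null-top `18`, a null-null sub-stratum chain-`16` in one step to a null-null `17`.

READING (for the planners of the strata line; no claim beyond the theorems): the sub-strata that p575885 / p576969 close by monomial
count at their own Descartes bound (`17`, `16`) are, GIVEN the door or the stubs, themselves DEFICIENT BY ONE (`≤ 16`, `≤ 15` in
chain currency): the line does not bottom out at any finite depth by monomial counting — each vanishing end coefficient re-opens the
deficiency-one question one Descartes step lower; conversely an alternation-sharp object on ANY such sub-stratum lifts, end by end,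
to a nineteen.  Whether deficiency one holds on the sub-strata is exactly as open as the stubs.

NOTHING here asserts that such objects exist or do not exist; nothing bounds `ζ_sym(3,4)` (registers `18 ≤ ζ_sym(3,4) ≤ 19`
unchanged); `DoorA34` and both stubs stay OPEN; nothing bears on `MatrixDescartes` (stmt-ValiantsHypothesis-18050) or on
`VP ≠ VNP` — VP≠VNP not moved.

[folklore] Alternation chains; letter reversal `t ↦ 1/t`; matrix determinant lemma.
-/

-- `Summit.ValiantsHypothesis.ValiantsHypothesis.…` repeats a component by the D-0017 layout
-- (single-conjunct summit), which the `dupNamespace` linter flags; the name is mandated.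
set_option linter.dupNamespace false

namespace Summit.ValiantsHypothesis.ValiantsHypothesis.Theorems.LacunarySymmetroidMatrixDescartes.Census

open Polynomial Finset
open scoped BigOperators Polynomial Matrix
open Summit.ValiantsHypothesis.ValiantsHypothesis.Theorems.MatrixDescartes.Negative (PosRootLawAt)

/-! ## The top versions (mirror `t ↦ 1/t`) -/

/-- **SUB-STRATUM LIFT (top end, one step, count currency).**  Let `d l < d 3` (`l ≠ 3`), `d l < d 2` (`l ∉ {2,3}`), the top letter
singular with `kᵀ adj(S₃) k ≠ 0`, `tr(adj S₃ · S₂) = 0` (the top sub-stratum of p575885), and let the pencil determinant carry an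
alternation chain of `N + 1` positive points.  Then for some real `η` the pencil with `S₂ ↦ S₂ + η·kkᵀ` (same support; `S₃`
untouched, so the object lies on the GENERIC null-top sheet `tr(adj S₃·S₂') ≠ 0`) has at least `N + 1` distinct positive det-roots.
With `N = 17`: a SUB-STRATUM chain-SEVENTEEN lifts to a null-top EIGHTEEN. [folklore] -/
theorem card_posRoots_of_nullTop_subStratum_step (d : Fin 4 → ℕ) (h3 : ∀ l, l ≠ 3 → d l < d 3)
    (h2 : ∀ l, l ≠ 3 → l ≠ 2 → d l < d 2)
    (S : Fin 4 → Matrix (Fin 3) (Fin 3) ℝ) (hdet : (S 3).det = 0) (htr : ((S 3).adjugate * S 2).trace = 0)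
    (k : Fin 3 → ℝ) (hk : k ⬝ᵥ ((S 3).adjugate *ᵥ k) ≠ 0)
    {N : ℕ} {s : ℝ} {a : Fin (N + 1) → ℝ}
    (hchain : AltChain ((∑ l, (X : ℝ[X]) ^ d l • (S l).map C).det) N s a) :
    ∃ η : ℝ, N + 1 ≤ ((((∑ l, (X : ℝ[X]) ^ d l •
      ((S l + if l = 2 then η • Matrix.vecMulVec k k else 0)).map C)).det).roots.toFinset.filter (fun t => 0 < t)).card := by
  classical
  have hd : ∀ l, d l ≤ d 3 := fun l => by
    by_cases hl : l = 3
    · rw [hl]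
    · exact (h3 l hl).le
  -- the mirrored, re-indexed pencil
  set d' : Fin 4 → ℕ := fun l => d 3 - d (Fin.rev l) with hd'
  set S' : Fin 4 → Matrix (Fin 3) (Fin 3) ℝ := fun l => S (Fin.rev l) with hS'
  have hrev0 : Fin.rev (0 : Fin 4) = 3 := by decide
  have hrev1 : Fin.rev (1 : Fin 4) = 2 := by decide
  have h01' : d' 0 < d' 1 := by
    simp only [hd', hrev0, hrev1]
    have := h3 2 (by decide)
    omega
  have h1' : ∀ l, l ≠ 0 → l ≠ 1 → d' 1 < d' l := by
    intro l hl hl1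
    have hne3 : Fin.rev l ≠ 3 := fun h => hl (by
      have := congrArg Fin.rev h; simpa using this)
    have hne2 : Fin.rev l ≠ 2 := fun h => hl1 (by
      have := congrArg Fin.rev h; simpa using this)
    simp only [hd', hrev1]
    have ha := h2 _ hne3 hne2
    have hb := h3 _ hne3
    have hc := h3 2 (by decide)
    omega
  have hdet' : (S' 0).det = 0 := by simp only [hS', hrev0]; exact hdet
  have htr' : ((S' 0).adjugate * S' 1).trace = 0 := by simp only [hS', hrev0, hrev1]; exact htr
  have hk' : k ⬝ᵥ ((S' 0).adjugate *ᵥ k) ≠ 0 := by simp only [hS', hrev0]; exact hk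
  -- mirrored chain, for the re-indexed mirrored pencil
  have hmir := altChain_mirror d (d 3) hd S hchain
  have hpencil : (∑ l, (X : ℝ[X]) ^ d' l • (S' l).map C) = ∑ l, (X : ℝ[X]) ^ (d 3 - d l) • (S l).map C := by
    simp only [hd', hS']
    exact pencil_comp_equiv Fin.revPerm (fun l => d 3 - d l) S
  have hchain' : AltChain ((∑ l, (X : ℝ[X]) ^ d' l • (S' l).map C).det) N
      ((((∑ l, (X : ℝ[X]) ^ d l • (S l).map C).det).eval (a (Fin.last N)))) (fun i => (a (Fin.rev i))⁻¹) := by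
    rw [hpencil]; exact hmir
  -- lift at the bottom of the mirrored pencil
  obtain ⟨η, s', a', hη⟩ := exists_altChain_of_nullBottom_sheetOne d' S' hdet' htr' k hk' h01' h1' hchain'
  refine ⟨η, ?_⟩
  -- mirror the count back
  set T : Fin 4 → Matrix (Fin 3) (Fin 3) ℝ := fun l => S l + if l = 2 then η • Matrix.vecMulVec k k else 0 with hT
  have hT' : (fun l => S' l + if l = 1 then η • Matrix.vecMulVec k k else 0) = fun l => T (Fin.rev l) := by
    funext l
    simp only [hS', hT]
    have : (l = 1) ↔ (Fin.rev l = 2) := by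
      constructor
      · intro h; rw [h]; decide
      · intro h; have := congrArg Fin.rev h; simpa using this
    by_cases hl : l = 1
    · rw [if_pos hl, if_pos (this.mp hl)]
    · rw [if_neg hl, if_neg (fun h => hl (this.mpr h))]
  have hpencilT : (∑ l, (X : ℝ[X]) ^ d' l • ((fun l => S' l + if l = 1 then η • Matrix.vecMulVec k k else 0) l).map C)
      = ∑ l, (X : ℝ[X]) ^ (d 3 - d l) • (T l).map C := by
    rw [hT']
    simp only [hd']
    exact pencil_comp_equiv Fin.revPerm (fun l => d 3 - d l) T
  have hcount := le_card_posRoots_of_altChain hη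
  rw [hpencilT, card_posRoots_det_pencil_mirror d (d 3) hd T] at hcount
  exact hcount

/-- **Sub-stratum lift composed with the null-end lift (top end, count currency).**  Under the hypotheses of
`card_posRoots_of_nullTop_subStratum_step`, for some reals `η₂, η₃` the pencil with `S₂ ↦ S₂ + η₂·kkᵀ` and then `S₃ ↦ S₃ + η₃·kkᵀ`
(same support) has at least `N + 2` distinct positive determinant roots.  With `N = 17`: a top SUB-STRATUM chain-SEVENTEEN lifts
to a NINETEEN. [folklore] -/
theorem card_posRoots_of_nullTop_subStratum (d : Fin 4 → ℕ) (h3 : ∀ l, l ≠ 3 → d l < d 3)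
    (h2 : ∀ l, l ≠ 3 → l ≠ 2 → d l < d 2)
    (S : Fin 4 → Matrix (Fin 3) (Fin 3) ℝ) (hdet : (S 3).det = 0) (htr : ((S 3).adjugate * S 2).trace = 0)
    (k : Fin 3 → ℝ) (hk : k ⬝ᵥ ((S 3).adjugate *ᵥ k) ≠ 0)
    {N : ℕ} {s : ℝ} {a : Fin (N + 1) → ℝ}
    (hchain : AltChain ((∑ l, (X : ℝ[X]) ^ d l • (S l).map C).det) N s a) :
    ∃ η₂ η₃ : ℝ, N + 2 ≤ ((((∑ l, (X : ℝ[X]) ^ d l •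
      (((S l + if l = 2 then η₂ • Matrix.vecMulVec k k else 0) + if l = 3 then η₃ • Matrix.vecMulVec k k else 0)).map C)).det
        ).roots.toFinset.filter (fun t => 0 < t)).card := by
  classical
  have hd : ∀ l, d l ≤ d 3 := fun l => by
    by_cases hl : l = 3
    · rw [hl]
    · exact (h3 l hl).le
  set d' : Fin 4 → ℕ := fun l => d 3 - d (Fin.rev l) with hd'
  set S' : Fin 4 → Matrix (Fin 3) (Fin 3) ℝ := fun l => S (Fin.rev l) with hS'
  have hrev0 : Fin.rev (0 : Fin 4) = 3 := by decide
  have hrev1 : Fin.rev (1 : Fin 4) = 2 := by decide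
  have h01' : d' 0 < d' 1 := by
    simp only [hd', hrev0, hrev1]
    have := h3 2 (by decide)
    omega
  have h1' : ∀ l, l ≠ 0 → l ≠ 1 → d' 1 < d' l := by
    intro l hl hl1
    have hne3 : Fin.rev l ≠ 3 := fun h => hl (by
      have := congrArg Fin.rev h; simpa using this)
    have hne2 : Fin.rev l ≠ 2 := fun h => hl1 (by
      have := congrArg Fin.rev h; simpa using this)
    simp only [hd', hrev1]
    have ha := h2 _ hne3 hne2
    have hb := h3 _ hne3
    have hc := h3 2 (by decide)
    omega
  have hdet' : (S' 0).det = 0 := by simp only [hS', hrev0]; exact hdet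
  have htr' : ((S' 0).adjugate * S' 1).trace = 0 := by simp only [hS', hrev0, hrev1]; exact htr
  have hk' : k ⬝ᵥ ((S' 0).adjugate *ᵥ k) ≠ 0 := by simp only [hS', hrev0]; exact hk
  have hmir := altChain_mirror d (d 3) hd S hchain
  have hpencil : (∑ l, (X : ℝ[X]) ^ d' l • (S' l).map C) = ∑ l, (X : ℝ[X]) ^ (d 3 - d l) • (S l).map C := by
    simp only [hd', hS']
    exact pencil_comp_equiv Fin.revPerm (fun l => d 3 - d l) S
  have hchain' : AltChain ((∑ l, (X : ℝ[X]) ^ d' l • (S' l).map C).det) N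
      ((((∑ l, (X : ℝ[X]) ^ d l • (S l).map C).det).eval (a (Fin.last N)))) (fun i => (a (Fin.rev i))⁻¹) := by
    rw [hpencil]; exact hmir
  obtain ⟨η₂, η₃, hη⟩ := card_posRoots_of_nullBottom_sheetOne d' S' hdet' htr' k hk' h01' h1' hchain'
  refine ⟨η₂, η₃, ?_⟩
  set T : Fin 4 → Matrix (Fin 3) (Fin 3) ℝ :=
    fun l => (S l + if l = 2 then η₂ • Matrix.vecMulVec k k else 0) + if l = 3 then η₃ • Matrix.vecMulVec k k else 0 with hT
  have hT' : (fun l => (S' l + if l = 1 then η₂ • Matrix.vecMulVec k k else 0) + if l = 0 then η₃ • Matrix.vecMulVec k k else 0)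
      = fun l => T (Fin.rev l) := by
    funext l
    simp only [hS', hT]
    have e1 : (l = 1) ↔ (Fin.rev l = 2) := by
      constructor
      · intro h; rw [h]; decide
      · intro h; have := congrArg Fin.rev h; simpa using this
    have e0 : (l = 0) ↔ (Fin.rev l = 3) := by
      constructor
      · intro h; rw [h]; decide
      · intro h; have := congrArg Fin.rev h; simpa using this
    by_cases hl : l = 1
    · rw [if_pos hl, if_pos (e1.mp hl)]
      have hl0 : l ≠ 0 := by rw [hl]; decide
      rw [if_neg hl0, if_neg (fun h => hl0 (e0.mpr h))]
    · rw [if_neg hl, if_neg (fun h => hl (e1.mpr h))]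
      by_cases hl0 : l = 0
      · rw [if_pos hl0, if_pos (e0.mp hl0)]
      · rw [if_neg hl0, if_neg (fun h => hl0 (e0.mpr h))]
  have hpencilT : (∑ l, (X : ℝ[X]) ^ d' l •
      ((fun l => (S' l + if l = 1 then η₂ • Matrix.vecMulVec k k else 0) + if l = 0 then η₃ • Matrix.vecMulVec k k else 0) l).map C)
      = ∑ l, (X : ℝ[X]) ^ (d 3 - d l) • (T l).map C := by
    rw [hT']
    simp only [hd']
    exact pencil_comp_equiv Fin.revPerm (fun l => d 3 - d l) T
  rw [hpencilT, card_posRoots_det_pencil_mirror d (d 3) hd T] at hη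
  exact hη

/-! ## Door and stub readings -/

/-- **DOOR-A READING (top sub-stratum chain-seventeens).**  On a support with `d l < d 3` (`l ≠ 3`) and `d l < d 2` (`l ∉ {2,3}`) where
the row `PosRootLawOn 3 4 18 d` holds, NO real symmetric `(3,4)` pencil ON THE SUB-STRATUM `det S₃ = 0`, `tr(adj S₃·S₂) = 0`
(`kᵀ adj(S₃) k ≠ 0` for some `k`) carries an alternation chain of `18` positive points: it would lift to a nineteen on `d`.
So the door forces DEFICIENCY ONE on p575885's sub-stratum as well (`≤ 16` in chain currency, against its Descartes bound `17`). [folklore] -/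
theorem no_nullTop_subStratum_seventeen_of_posRootLawOn {d : Fin 4 → ℕ} (hrow : PosRootLawOn 3 4 18 d)
    (h3 : ∀ l, l ≠ 3 → d l < d 3) (h2 : ∀ l, l ≠ 3 → l ≠ 2 → d l < d 2)
    (S : Fin 4 → Matrix (Fin 3) (Fin 3) ℝ) (hS : ∀ l, (S l).IsSymm) (hdet : (S 3).det = 0)
    (htr : ((S 3).adjugate * S 2).trace = 0)
    (k : Fin 3 → ℝ) (hk : k ⬝ᵥ ((S 3).adjugate *ᵥ k) ≠ 0) (s : ℝ) (a : Fin 18 → ℝ) :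
    ¬ AltChain ((∑ l, (X : ℝ[X]) ^ d l • (S l).map C).det) 17 s a := by
  intro hchain
  obtain ⟨η₂, η₃, h19⟩ := card_posRoots_of_nullTop_subStratum d h3 h2 S hdet htr k hk hchain
  have hsymm : ∀ l, ((S l + if l = 2 then η₂ • Matrix.vecMulVec k k else 0)
      + if l = 3 then η₃ • Matrix.vecMulVec k k else 0).IsSymm := fun l =>
    rankOne_update_letter_isSymm 3 _ (rankOne_update_letter_isSymm 2 S hS k η₂) k η₃ l
  have := hrow _ hsymm
  omega

/-- **DOOR-A READING (null-null sub-stratum chain-sixteens).**  On a support with `d 0 < d 1 < d l < d 3` where the row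
`PosRootLawOn 3 4 18 d` holds, NO real symmetric `(3,4)` pencil with BOTH end letters singular of adjugate rank and the bottom one on
its sub-stratum (`tr(adj S₀·S₁) = 0`) carries an alternation chain of `17` positive points: it would lift to a nineteen on `d`.
[folklore] -/
theorem no_nullNull_subStratum_sixteen_of_posRootLawOn {d : Fin 4 → ℕ} (hrow : PosRootLawOn 3 4 18 d)
    (h01 : d 0 < d 1) (h1 : ∀ l, l ≠ 0 → l ≠ 1 → d 1 < d l) (h3 : ∀ l, l ≠ 3 → d l < d 3)
    (S : Fin 4 → Matrix (Fin 3) (Fin 3) ℝ) (hS : ∀ l, (S l).IsSymm) (hdet0 : (S 0).det = 0)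
    (htr : ((S 0).adjugate * S 1).trace = 0) (hdet3 : (S 3).det = 0)
    (k₀ : Fin 3 → ℝ) (hk₀ : k₀ ⬝ᵥ ((S 0).adjugate *ᵥ k₀) ≠ 0)
    (k₃ : Fin 3 → ℝ) (hk₃ : k₃ ⬝ᵥ ((S 3).adjugate *ᵥ k₃) ≠ 0) (s : ℝ) (a : Fin 17 → ℝ) :
    ¬ AltChain ((∑ l, (X : ℝ[X]) ^ d l • (S l).map C).det) 16 s a := by
  intro hchain
  obtain ⟨η₁, η₀, η₃, h19⟩ := card_posRoots_of_nullNull_sheetOne d S hdet0 htr hdet3 k₀ hk₀ k₃ hk₃ h01 h1 h3 hchain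
  have hsymm : ∀ l, ((((S l + if l = 1 then η₁ • Matrix.vecMulVec k₀ k₀ else 0)
      + if l = 0 then η₀ • Matrix.vecMulVec k₀ k₀ else 0)) + if l = 3 then η₃ • Matrix.vecMulVec k₃ k₃ else 0).IsSymm := fun l =>
    rankOne_update_letter_isSymm 3 _
      (rankOne_update_letter_isSymm 0 _ (rankOne_update_letter_isSymm 1 S hS k₀ η₁) k₀ η₀) k₃ η₃ l
  have := hrow _ hsymm
  omega

/-- **STUB READING (`stub_nullTopCeiling` ⇒ deficiency one on the sub-stratum).**  If the strata line's second stub holds —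
VERBATIM: real symmetric letters, `StrictMono d`, `det S₃ = 0` ⇒ at most `17` distinct positive det-roots — then on every sorted
support NO real symmetric pencil on the sub-stratum `det S₃ = 0`, `tr(adj S₃·S₂) = 0` (`kᵀ adj(S₃) k ≠ 0`) carries an alternation
chain of `18` positive points (it would lift in ONE step to a null-top eighteen).  The stub is a hypothesis here, not a claim.
[folklore] -/
theorem no_nullTop_subStratum_seventeen_of_nullTopCeiling
    (hstub : ∀ (d : Fin 4 → ℕ) (S : Fin 4 → Matrix (Fin 3) (Fin 3) ℝ), (∀ l, (S l).IsSymm) → StrictMono d →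
      (S 3).det = 0 → ((∑ l, (Polynomial.X : Polynomial ℝ) ^ d l • (S l).map Polynomial.C).det.roots.toFinset.filter
        (fun t => 0 < t)).card ≤ 17)
    (d : Fin 4 → ℕ) (hd : StrictMono d)
    (S : Fin 4 → Matrix (Fin 3) (Fin 3) ℝ) (hS : ∀ l, (S l).IsSymm) (hdet : (S 3).det = 0)
    (htr : ((S 3).adjugate * S 2).trace = 0)
    (k : Fin 3 → ℝ) (hk : k ⬝ᵥ ((S 3).adjugate *ᵥ k) ≠ 0) (s : ℝ) (a : Fin 18 → ℝ) :
    ¬ AltChain ((∑ l, (X : ℝ[X]) ^ d l • (S l).map C).det) 17 s a := by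
  intro hchain
  have h3 : ∀ l, l ≠ 3 → d l < d 3 := by
    intro l hl; fin_cases l
    · exact hd (by decide)
    · exact hd (by decide)
    · exact hd (by decide)
    · exact absurd rfl hl
  have h2 : ∀ l, l ≠ 3 → l ≠ 2 → d l < d 2 := by
    intro l hl hl2; fin_cases l
    · exact hd (by decide)
    · exact hd (by decide)
    · exact absurd rfl hl2
    · exact absurd rfl hl
  obtain ⟨η, h18⟩ := card_posRoots_of_nullTop_subStratum_step d h3 h2 S hdet htr k hk hchain
  have hT3 : ((fun l : Fin 4 => S l + if l = 2 then η • Matrix.vecMulVec k k else 0) 3).det = 0 := by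
    simp only [show ((3 : Fin 4) = 2) ↔ False from by decide, if_false, add_zero]; exact hdet
  have := hstub d (fun l => S l + if l = 2 then η • Matrix.vecMulVec k k else 0)
    (rankOne_update_letter_isSymm 2 S hS k η) hd hT3
  omega

/-- **STUB READING (`stub_nullNullCeiling` ⇒ deficiency one on the null-null sub-stratum).**  If the strata line's third stub holds —
VERBATIM: real symmetric letters, `StrictMono d`, `det S₀ = 0`, `det S₃ = 0` ⇒ at most `16` distinct positive det-roots — then on
every sorted support NO real symmetric pencil with `det S₀ = det S₃ = 0` on the bottom sub-stratum `tr(adj S₀·S₁) = 0`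
(`kᵀ adj(S₀) k ≠ 0`) carries an alternation chain of `17` positive points (it would lift in ONE step — `S₁ ↦ S₁ + η kkᵀ`, both end
letters untouched — to a null-null seventeen).  The stub is a hypothesis here, not a claim. [folklore] -/
theorem no_nullNull_subStratum_sixteen_of_nullNullCeiling
    (hstub : ∀ (d : Fin 4 → ℕ) (S : Fin 4 → Matrix (Fin 3) (Fin 3) ℝ), (∀ l, (S l).IsSymm) → StrictMono d →
      (S 0).det = 0 → (S 3).det = 0 → ((∑ l, (Polynomial.X : Polynomial ℝ) ^ d l • (S l).map Polynomial.C).det.roots.toFinset.filter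
        (fun t => 0 < t)).card ≤ 16)
    (d : Fin 4 → ℕ) (hd : StrictMono d)
    (S : Fin 4 → Matrix (Fin 3) (Fin 3) ℝ) (hS : ∀ l, (S l).IsSymm) (hdet0 : (S 0).det = 0) (hdet3 : (S 3).det = 0)
    (htr : ((S 0).adjugate * S 1).trace = 0)
    (k : Fin 3 → ℝ) (hk : k ⬝ᵥ ((S 0).adjugate *ᵥ k) ≠ 0) (s : ℝ) (a : Fin 17 → ℝ) :
    ¬ AltChain ((∑ l, (X : ℝ[X]) ^ d l • (S l).map C).det) 16 s a := by
  intro hchain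
  have h01 : d 0 < d 1 := hd (by decide)
  have h1 : ∀ l, l ≠ 0 → l ≠ 1 → d 1 < d l := by
    intro l hl hl1; fin_cases l
    · exact absurd rfl hl
    · exact absurd rfl hl1
    · exact hd (by decide)
    · exact hd (by decide)
  obtain ⟨η, s', a', hchain'⟩ := exists_altChain_of_nullBottom_sheetOne d S hdet0 htr k hk h01 h1 hchain
  have hT0 : ((fun l : Fin 4 => S l + if l = 1 then η • Matrix.vecMulVec k k else 0) 0).det = 0 := by
    simp only [show ((0 : Fin 4) = 1) ↔ False from by decide, if_false, add_zero]; exact hdet0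
  have hT3 : ((fun l : Fin 4 => S l + if l = 1 then η • Matrix.vecMulVec k k else 0) 3).det = 0 := by
    simp only [show ((3 : Fin 4) = 1) ↔ False from by decide, if_false, add_zero]; exact hdet3
  have h17 := le_card_posRoots_of_altChain hchain'
  have := hstub d (fun l => S l + if l = 1 then η • Matrix.vecMulVec k k else 0)
    (rankOne_update_letter_isSymm 1 S hS k η) hd hT0 hT3
  omega

end Summit.ValiantsHypothesis.ValiantsHypothesis.Theorems.LacunarySymmetroidMatrixDescartes.Census
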